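import Literature.Geometry.Riemannian.HamiltonMaximumPrinciplePiece
import Literature.Geometry.Riemannian.CurvatureNormSq
import Literature.Geometry.Riemannian.RicciFlowScalarCurvatureEvolution
import HarnessLib

/-!
# Hamilton's maximum principle for the curvature ODE of the Ricci flow on a closed 4-manifold: proof

Discharge of the named fact `Literature.Geometry.Riemannian.hamilton_maximumPrinciple_curvatureODE`
(`HamiltonCurvatureODE.lean`; **Hamilton 1986, §4, Thm. 4.3** — "if the solutions of the ODE in
each fibre remain in the closed convex set `Z`, so do the solutions of the PDE", applied to the
curvature operator `∂M/∂t = ΔM + M² + M^#` after Uhlenbeck's trick, §2 and §6; **Chow–Lu 2004,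
Thm. 3** for time-dependent sets `Z(t)` with closed space-time track), by the argument assembled in
the tree:

1. **Charts.** The closed manifold is covered by finitely many compact chart pieces; in the chart
   at `c` the flow reads as a smooth family of metric components `G = chartRep I g c` solving the
   Ricci flow in coordinates (`IsRicciFlow.isMetricFamilyOn_chartRep`, `tDeriv_chartRep_eq`,
   `RicciFlowScalarCurvatureEvolution.lean`); a `g(s)`-orthonormal frame `e` at `Φ(y)` is
   `dΦ_y ∘ W` for a `G(s,y)`-orthonormal `W` (`isOrthonormalFrame_chart_iff`), and Hamilton's
   blocks of `(g s, cov s)` in the frame `e` are the blocks of the components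
   `rmComp (G s) y W` (`blocks_chart_eq`, from `chartRep_riemAt_eq_curvatureForm`).
2. **Continuity induction** (`HamiltonMP.Icc_induction`) on `P(s)`: "`Z s ≠ ∅` and every
   orthonormal frame at time `s` has its block vector within `ε e^{(Lip+1)s}` of `Z s`" (in the
   Euclidean model `ℝ^{27}`, `HamiltonMP.toEuc`), with `Lip` a Lipschitz constant of Hamilton's
   field near the compact range: the right step is `HamiltonMP.piece_right_step` (backward
   Uhlenbeck frame, `∂_t Rm = ΔRm + reaction` on the frame, the reaction identity
   `blocks(reaction) = (A² + BᵗB + 2A^#, AB + BC − 2B^#, C² + ᵗBB + 2C^#)`, the convexity estimate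
   along geodesics with parallel frames, the nearest point of `Z t₀` and the ODE-invariance of `Z`
   in the conjugated sign convention, `HamiltonODE.IsInvariantRel.reflect`), the left step is
   `HamiltonMP.piece_left_step` (closed space-time track).
3. `ε → 0`: the block vector lies in the closed set `Z s`.

* `hamilton_maximumPrinciple_curvatureODE_holds : hamilton_maximumPrinciple_curvatureODE`.

No new definition of `Prop` type; everything is proved.

## References

* R. S. Hamilton, *Four-manifolds with positive curvature operator*, J. Differential Geom. 24
  (1986) 153–179: §2 (p. 157), §3 (Lemma 3.1–3.5), §4 (Lemma 4.1, Thm. 4.2, Thm. 4.3,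
  pp. 160–163), §6 (p. 166). [Hamilton1986]
* B. Chow, P. Lu, *The time-dependent maximum principle for systems of parabolic equations subject
  to an avoidance set*, Pacific J. Math. 214 (2004) 201–222, §2, Thm. 3. [ChowLu2004]
* R. S. Hamilton, *Four-manifolds with positive isotropic curvature*, Comm. Anal. Geom. 5 (1997)
  1–92, §2.1, p. 7. [Hamilton1997]
* P. Topping, *Lectures on the Ricci flow*, LMS Lecture Note Series 325, CUP 2006, Prop. 2.5.1.
  [Topping2006]
-/

noncomputable section

set_option maxSynthPendingDepth 3

open Bundle Set Filter Metric Module Function TopologicalSpace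
open scoped Manifold ContDiff Topology NNReal

namespace Literature.Geometry.Riemannian

open Lorentzian Lorentzian.PseudoRiemannianMetric Lorentzian.MetricCoord CurvComp HamiltonODE HamiltonMP

/-! ### The chart dictionary for frames and blocks -/

section Chart

/-- Shorthand for the model space `ℝ⁴`. -/
local notation "E4" => EuclideanSpace ℝ (Fin 4)

variable {M : Type*} [TopologicalSpace M] [ChartedSpace E4 M] [IsManifold (𝓡 4) ∞ M]

/-- `dim ℝ⁴ = 4` (private copy; cf. `Literature.Geometry.Symplectic.finrank_E4`). [folklore] -/
private theorem finrank_E4 : finrank ℝ E4 = 4 := finrank_euclideanSpace_fin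

/-- The frame `dΦ_y ∘ W` at `Φ y` attached to a frame `W` of the model space. [folklore] -/
def chartFrame (x₀ : M) (y : chartTarget (𝓡 4) x₀) (W : Fin 4 → E4) :
    Fin 4 → TangentSpace (𝓡 4) (chartInv (𝓡 4) x₀ y) :=
  fun a ↦ mfderiv 𝓘(ℝ, E4) (𝓡 4) (chartInv (𝓡 4) x₀) y (W a)

/-- **Orthonormal frames read in the chart**: `dΦ_y ∘ W` is `g(s)`-orthonormal at `Φ y` iff `W`
is orthonormal for the components `chartRep I g x₀ s y` (`chartRep_apply`,
`val_chartPullback_apply`). [folklore] -/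
theorem isOrthonormalFrame_chart_iff
    (g : ℝ → PseudoRiemannianMetric (𝓡 4) ∞ E4 (TangentSpace (𝓡 4) : M → Type _)) (x₀ : M)
    (y : chartTarget (𝓡 4) x₀) (W : Fin 4 → E4) (s : ℝ) :
    (g s).IsOrthonormalFrame (chartInv (𝓡 4) x₀ y) (chartFrame x₀ y W) ↔
      IsONFrame (chartRep (𝓡 4) g x₀ s y) W := by
  have hval : ∀ v w : E4, chartRep (𝓡 4) g x₀ s y v w =
      (g s).val (chartInv (𝓡 4) x₀ y) (mfderiv 𝓘(ℝ, E4) (𝓡 4) (chartInv (𝓡 4) x₀) y v)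
        (mfderiv 𝓘(ℝ, E4) (𝓡 4) (chartInv (𝓡 4) x₀) y w) := fun v w ↦ by
    rw [chartRep_apply, val_chartPullback_apply]
  simp only [PseudoRiemannianMetric.IsOrthonormalFrame, IsONFrame, chartFrame, hval]
  constructor
  · rintro ⟨h1, h2⟩ i j
    by_cases hij : i = j
    · subst hij; simp [h1 i]
    · simp [hij, h2 i j hij]
  · intro h
    refine ⟨fun i ↦ by simpa using h i i, fun i j hij ↦ by simpa [hij] using h i j⟩

/-- The constant family at time `s` read in the chart is the family read at time `s`. [folklore] -/
theorem chartRep_const_eq (g : ℝ → PseudoRiemannianMetric (𝓡 4) ∞ E4 (TangentSpace (𝓡 4) : M → Type _))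
    (x₀ : M) (s : ℝ) : chartRep (𝓡 4) (fun _ ↦ g s) x₀ 0 = chartRep (𝓡 4) g x₀ s := rfl

/-- **Hamilton's blocks read in the chart**: for a Levi-Civita witness `cov` of `g s`, the block
triple of `(g s, cov)` at `Φ y` in the frame `dΦ_y ∘ W` is the triple `CurvComp.blocks` of the
components `rmComp (chartRep I g x₀ s) y W` (`chartRep_riemAt_eq_curvatureForm`).
[cite: Hamilton1997, §1.2, p. 5] -/
theorem blocks_chart_eq
    {g : ℝ → PseudoRiemannianMetric (𝓡 4) ∞ E4 (TangentSpace (𝓡 4) : M → Type _)}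
    {cov : ℝ → CovariantDerivative (𝓡 4) E4 (TangentSpace (𝓡 4) : M → Type _)} {s : ℝ}
    (hLC : (g s).IsLeviCivita (cov s)) (x₀ : M) (y : chartTarget (𝓡 4) x₀) (W : Fin 4 → E4) :
    ((g s).blockA (cov s) (chartInv (𝓡 4) x₀ y) (chartFrame x₀ y W),
      (g s).blockB (cov s) (chartInv (𝓡 4) x₀ y) (chartFrame x₀ y W),
      (g s).blockC (cov s) (chartInv (𝓡 4) x₀ y) (chartFrame x₀ y W)) =
    blocks (rmComp (chartRep (𝓡 4) g x₀ s) y W) := by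
  -- the components on the frame are the curvature form on the pushed-forward frame
  have hr : ∀ a b c d : Fin 4, rmComp (chartRep (𝓡 4) g x₀ s) y W a b c d =
      (g s).curvatureForm (cov s) (chartInv (𝓡 4) x₀ y) (chartFrame x₀ y W a) (chartFrame x₀ y W b)
        (chartFrame x₀ y W c) (chartFrame x₀ y W d) := by
    intro a b c d
    rw [rmComp_apply, ← chartRep_const_eq g x₀ s]
    exact chartRep_riemAt_eq_curvatureForm hLC x₀ y (W a) (W b) (W c) (W d)
  simp only [blocks, Prod.mk.injEq]
  refine ⟨?_, ?_, ?_⟩ <;> ext i j <;> fin_cases i <;> fin_cases j <;>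
    simp [PseudoRiemannianMetric.blockA, PseudoRiemannianMetric.blockB, PseudoRiemannianMetric.blockC,
      PseudoRiemannianMetric.pairingCurvature, PseudoRiemannianMetric.selfDualPairs,
      PseudoRiemannianMetric.antiSelfDualPairs, PseudoRiemannianMetric.bivectorCurvature, CurvComp.blockA,
      CurvComp.blockB, CurvComp.blockC, CurvComp.pairing, CurvComp.sdPairs, CurvComp.asdPairs, hr,
      Fin.sum_univ_two]

/-- **Every frame at a point of the chart domain is a chart frame**: for `x` in the domain of the
chart at `x₀` there are `y` in the target with `Φ y = x` such that every frame at `x` is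
`dΦ_y ∘ W`. [folklore] -/
theorem exists_chartFrame (x₀ : M) {x : M} (hx : x ∈ (chartAt E4 x₀).source) :
    ∃ y : chartTarget (𝓡 4) x₀, (y : E4) = extChartAt (𝓡 4) x₀ x ∧ chartInv (𝓡 4) x₀ y = x ∧
      ∀ e : Fin 4 → TangentSpace (𝓡 4) (chartInv (𝓡 4) x₀ y), ∃ W : Fin 4 → E4, chartFrame x₀ y W = e := by
  refine ⟨⟨extChartAt (𝓡 4) x₀ x, (extChartAt (𝓡 4) x₀).map_source (by rwa [extChartAt_source])⟩, rfl,
    chartInv_extChartAt x₀ hx, fun e ↦ ?_⟩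
  have hLi := isInvertible_mfderiv_of_injective rfl (injective_mfderiv_chartInv x₀
    ⟨extChartAt (𝓡 4) x₀ x, (extChartAt (𝓡 4) x₀).map_source (by rwa [extChartAt_source])⟩)
  refine ⟨fun a ↦ (mfderiv 𝓘(ℝ, E4) (𝓡 4) (chartInv (𝓡 4) x₀)
    ⟨extChartAt (𝓡 4) x₀ x, (extChartAt (𝓡 4) x₀).map_source (by rwa [extChartAt_source])⟩).inverse (e a),
    funext fun a ↦ ?_⟩
  simp only [chartFrame]
  exact hLi.self_apply_inverse (e a)

/-- **Orthonormal frames exist** at every point for a Riemannian metric (Gram–Schmidt read in the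
chart, `MetricCoord.exists_orthonormal_basis`). A public version with the same conclusion is the
tree's `exists_isOrthonormalFrame` (`NeumannIsotropicFormPos.lean`, via Kähler orthonormal frames);
this private chart-level copy only avoids importing that module's large closure. [folklore] -/
private theorem exists_isOrthonormalFrame_chart (g : PseudoRiemannianMetric (𝓡 4) ∞ E4 (TangentSpace (𝓡 4) : M → Type _))
    (hR : g.IsRiemannian) (x : M) : ∃ e : Fin 4 → TangentSpace (𝓡 4) x, g.IsOrthonormalFrame x e := by
  classical
  obtain ⟨y, -, hyx, -⟩ := exists_chartFrame x (mem_chart_source E4 x)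
  set G : E4 → E4 →L[ℝ] E4 →L[ℝ] ℝ := chartRep (𝓡 4) (fun _ ↦ g) x 0 with hG
  have hs : ∀ v w, G y v w = G y w v := fun v w ↦ chartRep_const_symm x y v w
  have hp : ∀ v, v ≠ 0 → 0 < G y v v := fun v hv ↦ chartRep_const_pos hR x y v hv
  obtain ⟨b, hb⟩ := MetricCoord.exists_orthonormal_basis hs hp
  set σ : Fin 4 ≃ Fin (finrank ℝ E4) := finCongr finrank_E4.symm with hσ
  set W : Fin 4 → E4 := fun a ↦ b (σ a) with hW
  have hON : IsONFrame (G y) W := by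
    intro i j
    rw [hW, hb]
    by_cases hij : i = j
    · subst hij; simp
    · have : σ i ≠ σ j := fun h ↦ hij (σ.injective h)
      simp [hij, this]
  have hframe := (isOrthonormalFrame_chart_iff (fun _ ↦ g) x y W 0).2 hON
  rw [← hyx]
  exact ⟨_, hframe⟩

end Chart

/-! ### The Euclidean model of the family `Z` -/

section Model

variable {Z : ℝ → Set Blocks}

/-- `toEuc '' Z s = ofEuc ⁻¹' Z s` (bijectivity of the model). [folklore] -/
theorem image_toEuc_eq (Z : ℝ → Set Blocks) (s : ℝ) : toEuc '' Z s = ofEuc ⁻¹' Z s := by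
  ext v
  constructor
  · rintro ⟨p, hp, rfl⟩; simpa using hp
  · intro h; exact ⟨ofEuc v, h, toEuc_ofEuc v⟩

/-- The model sets are closed. [folklore] -/
theorem isClosed_image_toEuc (hcl : ∀ t, IsClosed (Z t)) (s : ℝ) : IsClosed (toEuc '' Z s) := by
  rw [image_toEuc_eq]; exact (hcl s).preimage continuous_ofEuc

/-- The model sets are convex. [folklore] -/
theorem convex_image_toEuc (hconv : ∀ t, Convex ℝ (Z t)) (s : ℝ) : Convex ℝ (toEuc '' Z s) :=
  (hconv s).linear_image toEuc

/-- The space-time track of the model sets is closed. [folklore] -/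
theorem isClosed_track_toEuc (htrack : IsClosed {q : ℝ × Blocks | 0 ≤ q.1 ∧ q.2 ∈ Z q.1}) :
    IsClosed {q : ℝ × Euc | 0 ≤ q.1 ∧ q.2 ∈ toEuc '' Z q.1} := by
  have heq : {q : ℝ × Euc | 0 ≤ q.1 ∧ q.2 ∈ toEuc '' Z q.1} =
      (fun q : ℝ × Euc ↦ (q.1, ofEuc q.2)) ⁻¹' {q : ℝ × Blocks | 0 ≤ q.1 ∧ q.2 ∈ Z q.1} := by
    ext ⟨s, v⟩
    simp only [mem_setOf_eq, mem_preimage, image_toEuc_eq]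
  rw [heq]
  exact htrack.preimage (continuous_fst.prodMk (continuous_ofEuc.comp continuous_snd))

end Model

/-! ### The theorem -/

/-- Shorthand for the model space `ℝ⁴`. -/
local notation "E4" => EuclideanSpace ℝ (Fin 4)

universe u

set_option maxHeartbeats 1600000 in
/-- **Hamilton 1986, §4, Thm. 4.3 / Chow–Lu 2004, Thm. 3, for the curvature of the Ricci flow on a
closed 4-manifold** — the named fact `hamilton_maximumPrinciple_curvatureODE` holds: a family of
closed convex sets of block triples, symmetric under `B ↦ −B`, with closed space-time track and
forward invariant under Hamilton's ODE, which contains the blocks of `g(0)` in every orthonormal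
frame, contains the blocks of `g(t)` in every orthonormal frame for all `t ∈ [0, T)`. Proof as in
the module docstring (charts, the continuity induction with `HamiltonMP.piece_right_step` /
`piece_left_step`, `ε → 0`). [cite: Hamilton1986, §4, Thm. 4.3] [cite: ChowLu2004, §2, Thm. 3] -/
theorem hamilton_maximumPrinciple_curvatureODE_holds : hamilton_maximumPrinciple_curvatureODE.{u} := by
  intro M _ _ _ _ _ _ T g cov hflow hR Z hcl hconv htrack hrefl hinv h0 t ht
  classical
  -- `t = 0` is the hypothesis
  rcases ht.1.eq_or_lt with h0t | htpos
  · subst h0t; exact h0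
  -- the flow on `[0, t]`
  set t₁ : ℝ := t with ht₁def
  have ht₁ : 0 < t₁ := htpos
  have hsubT : Icc 0 t₁ ⊆ Ico 0 T := fun s hs ↦ ⟨hs.1, hs.2.trans_lt ht.2⟩
  have hflow' : IsRicciFlow g cov (Icc 0 t₁) := hflow.mono hsubT
  have hR' : ∀ s ∈ Icc 0 t₁, (g s).IsRiemannian := fun s hs ↦ hR s (hsubT hs)
  -- empty manifold: nothing to prove
  rcases isEmpty_or_nonempty M with hM | hM
  · intro x; exact (IsEmpty.false x).elim
  obtain ⟨xM⟩ := hM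
  -- (1) chart pieces
  have hρ : ∀ c : M, ∃ ρ > 0, closedBall (extChartAt (𝓡 4) c c) ρ ⊆ (extChartAt (𝓡 4) c).target := by
    intro c
    obtain ⟨r, hr, hrsub⟩ := Metric.isOpen_iff.1 (isOpen_extChartAt_target (I := 𝓡 4) c) _
      (mem_extChartAt_target (I := 𝓡 4) c)
    exact ⟨r / 2, half_pos hr, (closedBall_subset_ball (half_lt_self hr)).trans hrsub⟩
  choose ρ hρpos hρsub using hρ
  set Nbhd : M → Set M := fun c ↦ (chartAt E4 c).source ∩ (extChartAt (𝓡 4) c) ⁻¹' ball (extChartAt (𝓡 4) c c) (ρ c)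
    with hNbhd
  have hNopen : ∀ c, IsOpen (Nbhd c) := fun c ↦ by
    have hc' : ContinuousOn (extChartAt (𝓡 4) c) (chartAt E4 c).source := by
      rw [← extChartAt_source (I := 𝓡 4)]; exact continuousOn_extChartAt c
    exact hc'.isOpen_inter_preimage (chartAt E4 c).open_source isOpen_ball
  have hNmem : ∀ c, c ∈ Nbhd c := fun c ↦ ⟨mem_chart_source E4 c, mem_ball_self (hρpos c)⟩
  obtain ⟨tF, htF⟩ := isCompact_univ.elim_finite_subcover Nbhd hNopen fun x _ ↦ mem_iUnion.2 ⟨x, hNmem x⟩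
  have htFne : tF.Nonempty := by
    have := htF (mem_univ xM)
    simp only [mem_iUnion] at this
    obtain ⟨c, hc, -⟩ := this
    exact ⟨c, hc⟩
  -- chart data
  set G : M → ℝ → E4 → E4 →L[ℝ] E4 →L[ℝ] ℝ := fun c ↦ chartRep (𝓡 4) g c with hGdef
  set K : M → Set E4 := fun c ↦ closedBall (extChartAt (𝓡 4) c c) (ρ c) with hKdef
  have hKc : ∀ c, IsCompact (K c) := fun c ↦ isCompact_closedBall _ _
  have hKV : ∀ c, K c ⊆ (extChartAt (𝓡 4) c).target := fun c ↦ hρsub c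
  have hGfam : ∀ c, IsMetricFamilyOn (G c) (Icc 0 t₁) (extChartAt (𝓡 4) c).target := fun c ↦
    hflow'.isMetricFamilyOn_chartRep ht₁ c
  have hfl : ∀ c, ∀ s ∈ Icc 0 t₁, ∀ y ∈ (extChartAt (𝓡 4) c).target,
      tDeriv (G c) (Icc 0 t₁) s y = (-2 : ℝ) • ricAt (G c s) y := fun c s hs y hy ↦
    hflow'.tDeriv_chartRep_eq ht₁ c hs hy
  have hpos : ∀ c, ∀ s ∈ Icc 0 t₁, ∀ y ∈ (extChartAt (𝓡 4) c).target, ∀ v : E4, v ≠ 0 → 0 < G c s y v v := by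
    intro c s hs y hy v hv
    have h := chartPullback_pos (g s) c ⟨y, hy⟩ (fun w hw ↦ hR' s hs _ w hw) v hv
    rwa [← chartRep_apply] at h
  have h4 : finrank ℝ E4 = 4 := finrank_E4
  -- (2) the bound for the block vectors over all frame sets
  have hRc : ∀ c : M, ∃ R, ∀ p ∈ frameSet (G c) (K c) t₁, ‖bvecCLM (rArr (G c) p)‖ ≤ R := by
    intro c
    obtain ⟨hcpt, -⟩ := isCompact_frameSet (hGfam c) (hpos c) (hKc c) (hKV c)
    have hcont : ContinuousOn (fun p ↦ bvecCLM (rArr (G c) p)) (frameSet (G c) (K c) t₁) :=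
      bvecCLM.continuous.comp_continuousOn ((continuousOn_rArr (hGfam c)).mono fun p hp ↦ ⟨hKV c hp.1, hp.2.1⟩)
    exact hcpt.exists_bound_of_continuousOn hcont
  choose Rcf hRcf using hRc
  set Rc : ℝ := ∑ c ∈ tF, |Rcf c| with hRcdef
  have hRcb : ∀ c ∈ tF, ∀ p ∈ frameSet (G c) (K c) t₁, ‖bvecCLM (rArr (G c) p)‖ ≤ Rc := by
    intro c hc p hp
    calc ‖bvecCLM (rArr (G c) p)‖ ≤ Rcf c := hRcf c p hp
      _ ≤ |Rcf c| := le_abs_self _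
      _ ≤ Rc := Finset.single_le_sum (f := fun c ↦ |Rcf c|) (fun _ _ ↦ abs_nonneg _) hc
  -- (3) Hamilton's field near the range: Lipschitz constant and bound
  obtain ⟨Lip, hLip⟩ := contDiff_fieldEuc.contDiffOn.exists_lipschitzOnWith (by simp)
    (convex_closedBall (0 : Euc) (Rc + 4)) (isCompact_closedBall (0 : Euc) (Rc + 4))
  obtain ⟨MF₀, hMF₀⟩ := (isCompact_closedBall (0 : Euc) (Rc + 4)).exists_bound_of_continuousOn
    contDiff_fieldEuc.continuous.continuousOn
  set MF : ℝ := |MF₀| with hMFdef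
  have hMF : ∀ v ∈ closedBall (0 : Euc) (Rc + 4), ‖fieldEuc v‖ ≤ MF := fun v hv ↦ (hMF₀ v hv).trans (le_abs_self _)
  set L₁ : ℝ := (Lip : ℝ) + 1 with hL₁
  -- the model family
  set Z' : ℝ → Set Euc := fun s ↦ toEuc '' Z s with hZ'
  have hZ'cl : ∀ s, IsClosed (Z' s) := isClosed_image_toEuc hcl
  have hZ'conv : ∀ s, Convex ℝ (Z' s) := convex_image_toEuc hconv
  have hZ'track : IsClosed {q : ℝ × Euc | 0 ≤ q.1 ∧ q.2 ∈ Z' q.1} := isClosed_track_toEuc htrack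
  have hZ'inv : ∀ (β : ℝ → Euc) (a b : ℝ), 0 ≤ a → a ≤ b →
      (∀ σ ∈ Icc a b, HasDerivAt β (fieldEuc (β σ)) σ) → β a ∈ Z' a → β b ∈ Z' b :=
    fun β a b ha hab hβ hβa ↦ mem_image_of_isInvariant hinv hrefl ha hab hβ hβa
  -- the block triple of a frame and its chart expression
  set blk : ℝ → (x : M) → (Fin 4 → TangentSpace (𝓡 4) x) → Blocks := fun s x e ↦
    ((g s).blockA (cov s) x e, (g s).blockB (cov s) x e, (g s).blockC (cov s) x e) with hblk
  have hblk_chart : ∀ s ∈ Icc 0 t₁, ∀ (c : M) (y : chartTarget (𝓡 4) c) (W : Fin 4 → E4),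
      toEuc (blk s (chartInv (𝓡 4) c y) (chartFrame c y W)) = bvecCLM (rmComp (G c s) y W) := by
    intro s hs c y W
    rw [bvecCLM_apply, hblk]
    simp only
    rw [blocks_chart_eq (hflow'.isLeviCivita s hs) c y W]
  -- (4) the continuity induction, for a fixed small `ε`
  have hmain : ∀ ε : ℝ, 0 < ε → ε * Real.exp (L₁ * t₁) ≤ 1 → ∀ s ∈ Icc 0 t₁,
      (Z s).Nonempty ∧ ∀ (x : M) (e : Fin 4 → TangentSpace (𝓡 4) x), (g s).IsOrthonormalFrame x e →
        infDist (toEuc (blk s x e)) (Z' s) ≤ ε * Real.exp (L₁ * s) := by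
    intro ε hε hεsmall
    refine Icc_induction (P := fun s ↦ (Z s).Nonempty ∧ ∀ (x : M) (e : Fin 4 → TangentSpace (𝓡 4) x),
      (g s).IsOrthonormalFrame x e → infDist (toEuc (blk s x e)) (Z' s) ≤ ε * Real.exp (L₁ * s)) ?_ ?_ ?_
    · -- `s = 0`
      obtain ⟨e₀, he₀⟩ := exists_isOrthonormalFrame_chart (g 0) (hR' 0 ⟨le_rfl, ht₁.le⟩) xM
      refine ⟨⟨_, h0 xM e₀ he₀⟩, fun x e he ↦ ?_⟩
      have hmem : toEuc (blk 0 x e) ∈ Z' 0 := ⟨_, h0 x e he, rfl⟩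
      rw [infDist_zero_of_mem hmem]; positivity
    · -- right step
      intro t₀ ht₀ hP
      have hpiece : ∀ c ∈ tF, ∃ δ > 0, ∀ s ∈ Ioc t₀ (t₀ + δ), s ≤ t₁ → ∀ y ∈ K c, ∀ W : Fin 4 → E4,
          IsONFrame (G c s y) W → infDist (bvecCLM (rmComp (G c s) y W)) (Z' s) ≤ ε * Real.exp (L₁ * s) ∧
            (Z' s).Nonempty := by
        intro c hc
        have hP0 : ∀ y' ∈ (extChartAt (𝓡 4) c).target, ∀ W' : Fin 4 → E4, IsONFrame (G c t₀ y') W' →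
            infDist (bvecCLM (rmComp (G c t₀) y' W')) (Z' t₀) ≤ ε * Real.exp (((Lip : ℝ) + 1) * t₀) := by
          intro y' hy' W' hW'
          have hON := (isOrthonormalFrame_chart_iff g c ⟨y', hy'⟩ W' t₀).2 hW'
          have h := hP.2 _ _ hON
          rwa [hblk_chart t₀ ⟨ht₀.1, ht₀.2.le⟩ c ⟨y', hy'⟩ W'] at h
        have hne : (Z' t₀).Nonempty := hP.1.image _
        exact piece_right_step (hGfam c) (hfl c) (hpos c) h4 (hKc c) (hKV c) hZ'conv hZ'cl hZ'inv (hRcb c hc) hLip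
          (abs_nonneg MF₀) hMF hε hεsmall ht₀ hP0 hne
      choose! δf hδf hδP using hpiece
      set δ : ℝ := tF.inf' htFne δf with hδ
      have hδpos : 0 < δ := (Finset.lt_inf'_iff htFne).2 fun c hc ↦ hδf c hc
      refine ⟨δ, hδpos, fun s hs hs1 ↦ ?_⟩
      obtain ⟨c₀, hc₀⟩ := htFne
      have hsS : s ∈ Icc 0 t₁ := ⟨ht₀.1.trans hs.1.le, hs1⟩
      refine ⟨?_, fun x e he ↦ ?_⟩
      · have hδc₀ : δ ≤ δf c₀ := Finset.inf'_le _ hc₀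
        have h := (hδP c₀ hc₀ s ⟨hs.1, by linarith only [hs.2, hδc₀]⟩ hs1)
        -- nonemptiness from a frame of the piece `c₀` at its centre
        obtain ⟨y, hyE, -, hyW⟩ := exists_chartFrame c₀ (mem_chart_source E4 c₀)
        have hyK : (y : E4) ∈ K c₀ := by rw [hyE]; exact mem_closedBall_self (hρpos c₀).le
        obtain ⟨e₀, he₀⟩ := exists_isOrthonormalFrame_chart (g s) (hR' s hsS) (chartInv (𝓡 4) c₀ y)
        obtain ⟨W, hWe⟩ := hyW e₀
        rw [← hWe] at he₀
        have hW := (isOrthonormalFrame_chart_iff g c₀ y W s).1 he₀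
        obtain ⟨-, hne⟩ := h y hyK W hW
        obtain ⟨v, p, hp, rfl⟩ := hne
        exact ⟨p, hp⟩
      · -- the frame lies over some piece
        have hx := htF (mem_univ x)
        simp only [mem_iUnion] at hx
        obtain ⟨c, hc, hxN⟩ := hx
        obtain ⟨y, hyE, hyx, hyW⟩ := exists_chartFrame c hxN.1
        have hyK : (y : E4) ∈ K c := by
          rw [hyE]; exact ball_subset_closedBall hxN.2
        subst hyx
        obtain ⟨W, rfl⟩ := hyW e
        have hW := (isOrthonormalFrame_chart_iff g c y W s).1 he
        have hδc : δ ≤ δf c := Finset.inf'_le _ hc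
        have h := (hδP c hc s ⟨hs.1, by linarith only [hs.2, hδc]⟩ hs1 y hyK W hW).1
        rwa [hblk_chart s hsS c y W]
    · -- left step
      intro ts hts hbefore
      have htsS : ts ∈ Icc 0 t₁ := ⟨hts.1.le, hts.2⟩
      have hB : Continuous fun τ : ℝ ↦ ε * Real.exp (L₁ * τ) := by fun_prop
      have hframe : ∀ (x : M) (e : Fin 4 → TangentSpace (𝓡 4) x), (g ts).IsOrthonormalFrame x e →
          infDist (toEuc (blk ts x e)) (Z' ts) ≤ ε * Real.exp (L₁ * ts) ∧ (Z' ts).Nonempty := by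
        intro x e he
        have hx := htF (mem_univ x)
        simp only [mem_iUnion] at hx
        obtain ⟨c, hc, hxN⟩ := hx
        obtain ⟨y, hyE, hyx, hyW⟩ := exists_chartFrame c hxN.1
        subst hyx
        obtain ⟨W, rfl⟩ := hyW e
        have hW := (isOrthonormalFrame_chart_iff g c y W ts).1 he
        have hbefore' : ∀ s ∈ Ico 0 ts, (Z' s).Nonempty ∧ ∀ W' : Fin 4 → E4, IsONFrame (G c s y) W' →
            infDist (bvecCLM (rmComp (G c s) y W')) (Z' s) ≤ ε * Real.exp (L₁ * s) := by
          intro s hs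
          obtain ⟨hne, hbd⟩ := hbefore s hs
          refine ⟨hne.image _, fun W' hW' ↦ ?_⟩
          have hON := (isOrthonormalFrame_chart_iff g c y W' s).2 hW'
          have h := hbd _ _ hON
          rwa [hblk_chart s ⟨hs.1, hs.2.le.trans hts.2⟩ c y W'] at h
        have h := piece_left_step (hGfam c) (hfl c) h4 hZ'track hB hts y.2 hW hbefore'
        rwa [hblk_chart ts htsS c y W]
      obtain ⟨e₀, he₀⟩ := exists_isOrthonormalFrame_chart (g ts) (hR' ts htsS) xM
      refine ⟨?_, fun x e he ↦ (hframe x e he).1⟩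
      obtain ⟨v, p, hp, -⟩ := (hframe xM e₀ he₀).2
      exact ⟨p, hp⟩
  -- (5) `ε → 0`
  intro x e he
  have htS : t ∈ Icc 0 t₁ := ⟨ht.1, le_rfl⟩
  have hzero : infDist (toEuc (blk t x e)) (Z' t) = 0 := by
    refine le_antisymm (le_of_forall_pos_le_add fun η hη ↦ ?_) infDist_nonneg
    set ε : ℝ := min (η * Real.exp (-(L₁ * t₁))) (Real.exp (-(L₁ * t₁))) with hεdef
    have hεpos : 0 < ε := lt_min (by positivity) (Real.exp_pos _)
    have hεsmall : ε * Real.exp (L₁ * t₁) ≤ 1 := by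
      calc ε * Real.exp (L₁ * t₁) ≤ Real.exp (-(L₁ * t₁)) * Real.exp (L₁ * t₁) := by
            gcongr; exact min_le_right _ _
        _ = 1 := by rw [← Real.exp_add]; simp
    have h := ((hmain ε hεpos hεsmall t htS).2 x e he)
    have hexp : Real.exp (L₁ * t) ≤ Real.exp (L₁ * t₁) := Real.exp_le_exp.2 (by rw [ht₁def])
    calc infDist (toEuc (blk t x e)) (Z' t) ≤ ε * Real.exp (L₁ * t) := h
      _ ≤ (η * Real.exp (-(L₁ * t₁))) * Real.exp (L₁ * t₁) := by
          gcongr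
          exact min_le_left _ _
      _ = η := by rw [mul_assoc, ← Real.exp_add]; simp
      _ ≤ 0 + η := by rw [zero_add]
  have hne : (Z' t).Nonempty := ((hmain _ (Real.exp_pos (-(L₁ * t₁))) (by rw [← Real.exp_add]; simp) t htS).1).image _
  have hmem : toEuc (blk t x e) ∈ Z' t := by
    rw [← (hZ'cl t).closure_eq, mem_closure_iff_infDist_zero hne]
    exact hzero
  obtain ⟨p, hp, hpe⟩ := hmem
  have hpb : p = blk t x e := by rw [← ofEuc_toEuc p, hpe, ofEuc_toEuc]
  rw [hpb] at hp
  exact hp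

end Literature.Geometry.Riemannian

end
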